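import Summits.ResolutionOfSingularities.ResolutionOfSingularities.Theorems.ValuativePatchingRelBlowupExtension
import Literature.AlgebraicGeometry.Resolution.Temkin2008LocalizationProofs
import Literature.AlgebraicGeometry.Resolution.ResolutionLocalization
import Literature.AlgebraicGeometry.Resolution.ExcellentRingsFieldProofs
import Literature.AlgebraicGeometry.Resolution.PrincipalizationToResolution
import Literature.AlgebraicGeometry.Resolution.ComponentGluing
import Mathlib.AlgebraicGeometry.IdealSheaf.Functorial
import Mathlib.AlgebraicGeometry.PullbackCarrier
import HarnessLib

/-!
# Crux `PatchingPerfect` (stmt-ResolutionOfSingularities-16089), line `birth` (v5):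
# stub `stub_multiRoofGluing` (E2) — gluing finitely many regular roofs

Routes `ResolutionOfSingularities/IndSmooth` and `ResolutionOfSingularities/AbhyankarShadows`, crux
`PatchingPerfect` (Zariski's patching over ONE perfect field). This file proves the registered
stub `stub_multiRoofGluing` of the line `birth` (skeleton v5), verbatim.

**Statement.** Let `N` be an integral separated `k`-scheme of finite type, together with finitely
many proper birational dominations `q i : N → N' i` onto integral finite-type `k`-schemes of
dimension `≤ d`, such that every point of `N` has a regular image under some `q i` (`hcov`).
Assume the ENGINE OVER ONE REGULAR BASE (`hE`, the conclusion of the neighbouring stub E1): every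
integral `M` proper and birational over a regular integral finite-type `k`-scheme `B` of
dimension `≤ d` is desingularised by ONE blowing up whose centre misses the generic point and is
cosupported in `Sing M ∪ q⁻¹(F)` for a finite set `F` of closed points of `B`. Then `N` has a
resolution of singularities.

**Proof** (Piltant 2013, proof of Prop. 5.1, Step 2 — "blow up the Zariski closure of the
centre" — iterated over the finitely many roofs). Process the indices one at a time
(`Finset.induction_on`), keeping a proper birational `h : Y → N` with `Y` integral and the
invariant "every point of `Y` lying over `U i := (q i)⁻¹(Reg (N' i))` for a processed index `i`
is regular". THE STEP at the index `i` (`multiRoof_step`, applied to `t := h ≫ q i : Y → N' i`):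
`W := Reg (N' i)` is open (finite type over the quasi-excellent `Spec k`), and as an open
subscheme it is a regular integral finite-type `k`-scheme of dimension `≤ d`; `M := t⁻¹(W)` is a
non-empty open of `Y` (it contains the generic point), hence integral, and `r := t|_W : M → W` is
proper and birational (`IsBirational.morphismRestrict`). The engine `hE` gives a blowing up
`π : M' → M` along `J` with `M'` regular, `η_M ∉ Supp J` (so `J ≠ 0`) and
`Supp J ⊆ Sing M ∪ r⁻¹(F)`, `F` a finite set of closed points of `W`. Extend it to the blowing
up `ρ : Z → Y` of `Y` along the push-forward ideal `J.map M.ι` (`exists_isPullback_of_isBlowup_opens`: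
`Z` integral, `ρ` proper birational, `M' = Z ×_Y M` along an open immersion `s : M' → Z`).
Regularity bookkeeping: (A) over `M`, `Z` is `M'`, regular (stalks along the open immersion
`s`); (B) at a point `y = ρ z ∉ M` which is regular on `Y`: the support of `J.map M.ι` is the
closure of `Supp J` in `Y` (`Scheme.IdealSheafData.support_map`), contained in the closed set
`Sing Y ∪ t⁻¹(F)` — the points of `F`, closed in the open `W` of the JACOBSON space `N' i`, are
closed in `N' i` (`IsOpenEmbedding.preimage_closedPoints`), so `t⁻¹(F)` is closed in `Y`, and it
lies inside `M`; hence `y ∉ Supp (J.map M.ι)`, `ρ` is an isomorphism near `z`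
(`IsBlowup.isIso_compl`) and `z` is regular (`mem_regularLocus_iff_of_isIso_morphismRestrict`).
So the new model `Z → Y → N` is regular over `U i` (case A) and over every processed `U i'`
(case A or B). At the end every point of `N` lies in some `U i` (`hcov`), the final model is
regular, proper and birational over `N`, whence `Scheme.HasResolution N`
(`Scheme.HasResolution.of_isBirational`).

## References

* O. Piltant, *An axiomatic version of Zariski's patching theorem*, RACSAM 107 (2013) 91–121,
  Prop. 5.1 (proof, Step 2). [Piltant2013]
* M. Temkin, *Desingularization of quasi-excellent schemes in characteristic zero*, Adv. Math.
  219 (2008) 488–522, Lemma 2.1.4 (blowing ups and their extensions from opens). [Temkin2008]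
* The Stacks Project, Tag 02OS (a blowing up is an isomorphism off its centre), Tag 01TB
  (closed points of opens of Jacobson schemes). [StacksProject]
-/

set_option linter.dupNamespace false -- single-problem summit: doubled namespace component is forced

noncomputable section

open CategoryTheory CategoryTheory.Limits AlgebraicGeometry Literature.AlgebraicGeometry.Resolution
open TopologicalSpace

namespace Summit.ResolutionOfSingularities.ResolutionOfSingularities.Theorems

/-- **The step of the multi-roof gluing** (Piltant 2013, proof of Prop. 5.1, Step 2, for one
roof). Let `Y` (integral, of finite type over `k`) be proper and birational over an integral
finite-type `k`-scheme `B₀` of dimension `≤ d` via `t`, and assume the engine over one regular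
base (`hE`). Then there is a proper birational `ρ : Z → Y` with `Z` integral such that a point
`z` of `Z` is regular as soon as `t (ρ z)` is a regular point of `B₀` OR `ρ z` is a regular point
of `Y`. Construction: `W := Reg B₀` (open; a regular integral finite-type `k`-scheme of dimension
`≤ d`), `M := t⁻¹(W)`, `r := t|_W : M → W` (proper birational); `hE` blows `M` up along `J` with
regular result, `η ∉ Supp J ⊆ Sing M ∪ r⁻¹(F)`, `F` finite and closed in `W`; the blowing up
`ρ` of `Y` along `J.map M.ι` restricts to it over `M` (`exists_isPullback_of_isBlowup_opens`) and
is an isomorphism off `closure (Supp J) ⊆ Sing Y ∪ t⁻¹(F)` (`F` is closed in the Jacobson space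
`B₀`, and `t⁻¹(F) ⊆ M`). [cite: Piltant2013, Prop. 5.1 (proof, Step 2)] -/
theorem multiRoof_step {d : ℕ} {k : Type} [Field k]
    (hE : ∀ (B M : Scheme.{0}) (gB : B ⟶ Spec (.of k)) [LocallyOfFiniteType gB] [QuasiCompact gB]
      [IsIntegral B], Scheme.IsRegular B → topologicalKrullDim B ≤ d →
      ∀ (q : M ⟶ B) [IsProper q] [IsIntegral M], IsBirational q →
        ∃ (J : M.IdealSheafData) (M' : Scheme.{0}) (π : M' ⟶ M), IsBlowup π J ∧
          genericPoint M ∉ (J.support : Set M) ∧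
          (∃ F : Set B, F.Finite ∧ (∀ n ∈ F, IsClosed ({n} : Set B)) ∧
            ∀ m : M, m ∈ J.support → m ∉ Scheme.regularLocus M ∨ q.base m ∈ F) ∧
          Scheme.IsRegular M')
    {Y B₀ : Scheme.{0}} (gY : Y ⟶ Spec (.of k)) [LocallyOfFiniteType gY] [QuasiCompact gY]
    [IsIntegral Y] (g₀ : B₀ ⟶ Spec (.of k)) [LocallyOfFiniteType g₀] [QuasiCompact g₀]
    [IsIntegral B₀] (hdim : topologicalKrullDim B₀ ≤ d) (t : Y ⟶ B₀) [IsProper t]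
    (ht : IsBirational t) :
    ∃ (Z : Scheme.{0}) (ρ : Z ⟶ Y), IsIntegral Z ∧ IsProper ρ ∧ IsBirational ρ ∧
      ∀ z : Z, (t.base (ρ.base z) ∈ Scheme.regularLocus B₀ ∨
        ρ.base z ∈ Scheme.regularLocus Y) → z ∈ Scheme.regularLocus Z := by
  -- everything in sight is Noetherian; `B₀` is a Jacobson space; singular loci are closed
  haveI : IsNoetherian Y := Scheme.isNoetherian_of_finiteType_over_field gY
  haveI : IsNoetherian B₀ := Scheme.isNoetherian_of_finiteType_over_field g₀
  haveI : JacobsonSpace B₀ := LocallyOfFiniteType.jacobsonSpace g₀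
  have hk : Scheme.IsQuasiExcellent (Spec (.of k)) :=
    Scheme.isQuasiExcellent_of_locallyOfFiniteType Stacks07QW_field_holds (𝟙 _)
  have hSingY : IsClosed (Scheme.regularLocus Y)ᶜ :=
    isClosed_compl_regularLocus_of_locallyOfFiniteType gY hk
  -- the regular locus `W` of the base, as an open subscheme: regular, integral, `dim ≤ d`
  let W : B₀.Opens := ⟨Scheme.regularLocus B₀, isOpen_regularLocus_of_locallyOfFiniteType g₀ hk⟩
  have hηW : genericPoint B₀ ∈ W := genericPoint_mem_regularLocus B₀
  haveI : Nonempty (W : Scheme.{0}) := ⟨⟨_, hηW⟩⟩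
  have hWreg : Scheme.IsRegular (W : Scheme.{0}) := fun x =>
    (Scheme.mem_regularLocus x).mp ((mem_regularLocus_iff_of_flat_of_isPreimmersion W.ι x).mpr x.2)
  have hWdim : topologicalKrullDim (W : Scheme.{0}) ≤ d :=
    W.ι.isOpenEmbedding.isInducing.topologicalKrullDim_le.trans hdim
  -- the open `M = t⁻¹(W)` of `Y` (non-empty: it contains the generic point) and `r = t|_W`
  let M : Y.Opens := t ⁻¹ᵁ W
  have hηM : genericPoint Y ∈ M := by
    obtain ⟨U, hU, -, hiso⟩ := ht
    haveI := hiso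
    show t (genericPoint Y) ∈ W
    rw [apply_genericPoint_eq_of_isIso_morphismRestrict t U hU]
    exact hηW
  haveI : Nonempty (M : Scheme.{0}) := ⟨⟨_, hηM⟩⟩
  have hr : IsBirational (t ∣_ W) := ht.morphismRestrict W
  -- THE ENGINE over the regular base `W`
  obtain ⟨J, M', π, hπ, hηJ, ⟨F, hFfin, hFcl, hJF⟩, hM'reg⟩ :=
    hE (W : Scheme.{0}) (M : Scheme.{0}) (W.ι ≫ g₀) hWreg hWdim (t ∣_ W) hr
  have hJ : J ≠ ⊥ := by
    rintro rfl
    apply hηJ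
    rw [Scheme.IdealSheafData.support_bot]
    trivial
  -- extend the blowing up from the open `M` to `Y` (push-forward centre `J.map M.ι`)
  obtain ⟨Z, ρ, s, hZ, hρ, hρbir, hs, hsq, hρJ⟩ := exists_isPullback_of_isBlowup_opens M hJ hπ
  haveI := hZ
  haveI := hρ
  haveI := hs
  -- the points of `F` are closed in `B₀` (Jacobson), so `P = t⁻¹(F)` is closed in `Y`, `P ⊆ M`
  have hFcl' : ∀ n ∈ F, IsClosed ({n.1} : Set B₀) := fun n hn => by
    have h1 : n ∈ W.ι ⁻¹' closedPoints B₀ := by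
      rw [W.ι.isOpenEmbedding.preimage_closedPoints]
      exact hFcl n hn
    exact h1
  set P : Set Y := ⋃ n ∈ F, t ⁻¹' {n.1} with hP
  have hPcl : IsClosed P :=
    hFfin.isClosed_biUnion fun n hn => (hFcl' n hn).preimage t.continuous
  have hPM : P ⊆ (M : Set Y) := by
    intro y hy
    simp only [hP, Set.mem_iUnion, Set.mem_preimage, Set.mem_singleton_iff] at hy
    obtain ⟨n, -, hy⟩ := hy
    show t y ∈ W
    rw [hy]
    exact n.2
  -- the support of the push-forward centre lies in `Sing Y ∪ P`
  have hsupp : ((J.map M.ι).support : Set Y) ⊆ (Scheme.regularLocus Y)ᶜ ∪ P := by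
    rw [Scheme.IdealSheafData.support_map, Closeds.coe_closure]
    refine closure_minimal ?_ (hSingY.union hPcl)
    rintro _ ⟨m, hm, rfl⟩
    rcases hJF m hm with h | h
    · exact Or.inl fun h' => h ((mem_regularLocus_iff_of_flat_of_isPreimmersion M.ι m).mpr h')
    · refine Or.inr (Set.mem_biUnion h ?_)
      rw [Set.mem_preimage, Set.mem_singleton_iff, Scheme.Opens.ι_apply,
        ← morphismRestrict_base_coe t W m]
  refine ⟨Z, ρ, hZ, hρ, hρbir, fun z hz => ?_⟩
  by_cases hzM : ρ z ∈ M
  · -- (A) over `M`, `Z` is the regular `M'`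
    obtain ⟨m', hm'₁, -⟩ := Scheme.exists_preimage_of_isPullback hsq z (⟨ρ z, hzM⟩ : M) rfl
    haveI : IsRegularLocalRing (M'.presheaf.stalk m') := hM'reg m'
    rw [Scheme.mem_regularLocus, ← hm'₁]
    exact IsRegularLocalRing.of_ringEquiv (asIso (s.stalkMap m')).commRingCatIsoToRingEquiv.symm
  · -- (B) off `M`, at a regular point of `Y`: `ρ` is an isomorphism near `z`
    have hzY : ρ z ∈ Scheme.regularLocus Y := hz.resolve_left hzM
    have hzJ : ρ z ∉ ((J.map M.ι).support : Set Y) := fun h =>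
      (hsupp h).elim (fun h' => h' hzY) fun h' => hzM (hPM h')
    haveI := hρJ.isIso_compl
    exact (mem_regularLocus_iff_of_isIso_morphismRestrict ρ
      ⟨((J.map M.ι).support : Set Y)ᶜ, (J.map M.ι).support.isClosed.isOpen_compl⟩ z hzJ).mpr hzY

/-- **STUB E2 `stub_multiRoofGluing` — GLUING FINITELY MANY REGULAR ROOFS** (registered
signature verbatim). Let `N` be an integral separated `k`-scheme of finite type with finitely
many proper birational dominations `q i : N → N' i` onto integral finite-type `k`-schemes of
dimension `≤ d` such that every point of `N` has a regular image under some `q i`. Given the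
engine over one regular base (`hE`, the conclusion of stub E1), `N` has a resolution of
singularities. PROOF: induction over finite sets `s` of indices (`Finset.induction_on`) carrying a
proper birational `h : Y → N`, `Y` integral, such that every point of `Y` over
`⋃_{i ∈ s} (q i)⁻¹(Reg (N' i))` is regular (start: `Y = N`, `h = 𝟙`); the step at a new index `i`
is `multiRoof_step` applied to `t = h ≫ q i` (the new model is regular over `(q i)⁻¹(Reg (N' i))`
and stays regular over the processed indices); at `s = univ` every point of `N` is covered
(`hcov`), so the final model is regular, proper and birational over `N`.
[cite: Piltant2013, Prop. 5.1 (proof, Step 2)] [cite: Temkin2008, Lemma 2.1.4] -/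
theorem stub_multiRoofGluing (d : ℕ) (k : Type) [Field k]
    (hE : ∀ (B M : Scheme.{0}) (gB : B ⟶ Spec (.of k)) [LocallyOfFiniteType gB] [QuasiCompact gB]
      [IsIntegral B], Scheme.IsRegular B → topologicalKrullDim B ≤ d →
      ∀ (q : M ⟶ B) [IsProper q] [IsIntegral M], IsBirational q →
        ∃ (J : M.IdealSheafData) (M' : Scheme.{0}) (π : M' ⟶ M), IsBlowup π J ∧
          genericPoint M ∉ (J.support : Set M) ∧
          (∃ F : Set B, F.Finite ∧ (∀ n ∈ F, IsClosed ({n} : Set B)) ∧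
            ∀ m : M, m ∈ J.support → m ∉ Scheme.regularLocus M ∨ q.base m ∈ F) ∧
          Scheme.IsRegular M')
    (N : Scheme.{0}) (gN : N ⟶ Spec (.of k)) [IsSeparated gN] [LocallyOfFiniteType gN]
    [QuasiCompact gN] [IsIntegral N] (ι : Type) [Finite ι] (N' : ι → Scheme.{0})
    (g' : (i : ι) → (N' i ⟶ Spec (.of k))) [∀ i, LocallyOfFiniteType (g' i)]
    [∀ i, QuasiCompact (g' i)] [∀ i, IsIntegral (N' i)]
    (hdim : ∀ i, topologicalKrullDim (N' i) ≤ d)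
    (q : (i : ι) → (N ⟶ N' i)) [∀ i, IsProper (q i)] (hq : ∀ i, IsBirational (q i))
    (hcov : ∀ n : N, ∃ i, IsRegularLocalRing ((N' i).presheaf.stalk ((q i).base n))) :
    Scheme.HasResolution N := by
  classical
  -- induction over finite sets of processed indices
  have key : ∀ s : Finset ι, ∃ (Y : Scheme.{0}) (h : Y ⟶ N), IsIntegral Y ∧ IsProper h ∧
      IsBirational h ∧ ∀ y : Y, (∃ i ∈ s, (q i).base (h.base y) ∈ Scheme.regularLocus (N' i)) →
        y ∈ Scheme.regularLocus Y := by
    intro s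
    induction s using Finset.induction_on with
    | empty =>
      refine ⟨N, 𝟙 N, inferInstance, inferInstance, ⟨⊤, by simp, by simp, inferInstance⟩, ?_⟩
      rintro y ⟨i, hi, -⟩
      simp at hi
    | insert i s _ ih =>
      obtain ⟨Y, h, hY, hh, hhbir, hreg⟩ := ih
      haveI := hY
      haveI := hh
      obtain ⟨Z, ρ, hZ, hρ, hρbir, hZreg⟩ :=
        multiRoof_step hE (h ≫ gN) (g' i) (hdim i) (h ≫ q i) (hhbir.comp (hq i))
      haveI := hZ
      haveI := hρ
      refine ⟨Z, ρ ≫ h, inferInstance, inferInstance, hρbir.comp hhbir, ?_⟩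
      rintro z ⟨j, hj, hjreg⟩
      apply hZreg z
      rcases Finset.mem_insert.mp hj with rfl | hj
      · left
        simpa only [Scheme.Hom.comp_base, TopCat.coe_comp, Function.comp_apply] using hjreg
      · right
        refine hreg _ ⟨j, hj, ?_⟩
        simpa only [Scheme.Hom.comp_base, TopCat.coe_comp, Function.comp_apply] using hjreg
  -- all indices processed: every point is covered (`hcov`), so the model is regular
  haveI := Fintype.ofFinite ι
  obtain ⟨Y, h, hY, hh, hhbir, hreg⟩ := key Finset.univ
  haveI := hY
  haveI := hh
  refine Scheme.HasResolution.of_isBirational h hhbir (Scheme.IsRegular.hasResolution fun y => ?_)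
  obtain ⟨i, hi⟩ := hcov (h.base y)
  exact (Scheme.mem_regularLocus y).mp
    (hreg y ⟨i, Finset.mem_univ i, (Scheme.mem_regularLocus _).mpr hi⟩)

end Summit.ResolutionOfSingularities.ResolutionOfSingularities.Theorems

end
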